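import Mathlib
import Literature.Analysis.FluidPDE.EnstrophySplittingDissipation
import Summits.NavierStokesRegularity.NavierStokesRegularity.Theorems.LevelSetModerationLevelSetEnergyInequalityTruncation
import Summits.NavierStokesRegularity.NavierStokesRegularity.Theorems.LevelSetModerationLevelSetEnergyInequalityRegularisation

/-!
# Route LevelSetModeration — `LevelSetEnergyInequality`: the regularised viscous identity (helper file 3a)

Support lemmas for item stmt-NavierStokesRegularity-18151 (Vasseur 2007, Lemma 11, the step
"`|∇|u|| ≤ |∇u|`" of the level-set energy inequality, globalised). For a `C²` field `u` on `ℝ³`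
with `u, Du, D²u ∈ L²` and a level `c > 0`, with the truncation weight
`k₀(u) = (|u| - c)₊ / max(|u|, c)` (`= (1 - c/|u|)₊`):

  `∫ h(k₀(u)) ⟪Δu, u⟫ ≤ -∫ (h(k₀) + h'(k₀)(1 - k₀)) Σᵢ ⟪u, ∂ᵢu⟫² / max(|u|,c)²`   (`viscous_step`)

for every smooth `h` vanishing near `0` (the regularised form of "`|∇|u|| ≤ |∇u|`"; the limit
`h → id` is taken in file 3b, `viscous_slice`). Proof: the test field `h(k₀(u)) u` is `C¹`
(`hasFDerivAt_regularisedField`: on `{|u| > c}` the chain rule through `k₀ = 1 - c/|u|`, on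
`{k₀ < δ}` it vanishes identically); integrate by parts on the whole space (Mathlib
`integral_bilinear_hasFDerivAt_right_eq_neg_left_of_integrable`, all pairings `L¹` because
`u, Du, D²u ∈ L²`): `∫ h(k₀)⟪Δu, u⟫ = -∫ [h(k₀)|∇u|² + h'(k₀)(1 - k₀) G]`,
`G = Σᵢ⟪u, ∂ᵢu⟫²/max(|u|,c)² ≤ |∇u|²` (`levelGradSq_le_sum_sq`), and drop `h(k₀)(|∇u|² - G) ≥ 0`.

## References
* A. F. Vasseur, NoDEA 14 (2007), Lemma 11 and its proof, (12). [Vasseur2007]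
-/

noncomputable section

-- single-conjunct summit: `Summit.<Summit>.<Problem>` repeats the name by the D-0017 layout
set_option linter.dupNamespace false

namespace Summit.NavierStokesRegularity.NavierStokesRegularity.Theorems.LevelSetEnergyInequality

open Real Set Filter Topology MeasureTheory InnerProductSpace
open scoped RealInnerProductSpace ENNReal Laplacian
open Literature.Analysis.FluidPDE

/-- `G = Σᵢ ⟪u, ∂ᵢu⟫² / max(|u|, c)² ≤ Σᵢ ‖∂ᵢu‖²` (Cauchy–Schwarz termwise, `|u| ≤ max(|u|, c)`). -/
theorem levelGradSq_le_sum_sq {c : ℝ} (hc : 0 < c)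
    (u : EuclideanSpace ℝ (Fin 3) → EuclideanSpace ℝ (Fin 3)) (x : EuclideanSpace ℝ (Fin 3)) :
    (∑ i, ⟪u x, fderiv ℝ u x (EuclideanSpace.basisFun (Fin 3) ℝ i)⟫ ^ 2) / max ‖u x‖ c ^ 2 ≤
      ∑ i, ‖fderiv ℝ u x (EuclideanSpace.basisFun (Fin 3) ℝ i)‖ ^ 2 := by
  set e := EuclideanSpace.basisFun (Fin 3) ℝ
  have hm : 0 < max ‖u x‖ c := lt_of_lt_of_le hc (le_max_right _ _)
  rw [div_le_iff₀ (pow_pos hm 2)]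
  calc ∑ i, ⟪u x, fderiv ℝ u x (e i)⟫ ^ 2 ≤ ∑ i, ‖u x‖ ^ 2 * ‖fderiv ℝ u x (e i)‖ ^ 2 := by
        refine Finset.sum_le_sum fun i _ => ?_
        rw [← mul_pow, ← sq_abs]
        exact pow_le_pow_left₀ (abs_nonneg _) (abs_real_inner_le_norm _ _) 2
    _ = ‖u x‖ ^ 2 * ∑ i, ‖fderiv ℝ u x (e i)‖ ^ 2 := by rw [Finset.mul_sum]
    _ ≤ max ‖u x‖ c ^ 2 * ∑ i, ‖fderiv ℝ u x (e i)‖ ^ 2 := by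
        gcongr
        exact le_max_left _ _
    _ = (∑ i, ‖fderiv ℝ u x (e i)‖ ^ 2) * max ‖u x‖ c ^ 2 := mul_comm _ _

/-- **Derivative of the regularised test field** `w = h(k₀(u)) u`, where `h` is differentiable and
vanishes together with `h'` on `(-∞, δ]`, `δ > 0`:
`Dw(x) = h(k₀) Du(x) + (c h'(k₀)/max(|u|,c)³) ⟪u, Du(x)·⟫ u` (on `{|u| > c}` this is the chain
rule through `k₀(u) = 1 - c/|u|`; on `{k₀(u) < δ}` both sides vanish). -/
theorem hasFDerivAt_regularisedField {c : ℝ} (hc : 0 < c)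
    {u : EuclideanSpace ℝ (Fin 3) → EuclideanSpace ℝ (Fin 3)} (hud : Differentiable ℝ u)
    {h h' : ℝ → ℝ} (hder : ∀ y, HasDerivAt h (h' y) y)
    {δ : ℝ} (hδ : 0 < δ) (hδ0 : ∀ y, y ≤ δ → h y = 0 ∧ h' y = 0) (x : EuclideanSpace ℝ (Fin 3)) :
    HasFDerivAt (fun y => h (max (‖u y‖ - c) 0 / max ‖u y‖ c) • u y)
      (h (max (‖u x‖ - c) 0 / max ‖u x‖ c) • fderiv ℝ u x +
        (c * h' (max (‖u x‖ - c) 0 / max ‖u x‖ c) / max ‖u x‖ c ^ 3) •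
          ((innerSL ℝ (u x)).comp (fderiv ℝ u x)).smulRight (u x)) x := by
  obtain ⟨k, hk⟩ : ∃ k : EuclideanSpace ℝ (Fin 3) → ℝ, k = fun v => max (‖v‖ - c) 0 / max ‖v‖ c :=
    ⟨_, rfl⟩
  have hkx : ∀ v, k v = max (‖v‖ - c) 0 / max ‖v‖ c := fun v => by rw [hk]
  have cu : Continuous u := hud.continuous
  have cku : Continuous fun y => k (u y) := by rw [hk]; exact (continuous_weight hc).comp cu
  simp only [← hkx]
  rcases lt_or_ge (k (u x)) δ with hlt | hge
  · -- `w` vanishes near `x`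
    have hopen : IsOpen {y | k (u y) < δ} := isOpen_lt cku continuous_const
    have hev : (fun y => h (k (u y)) • u y) =ᶠ[𝓝 x] fun _ => 0 := by
      filter_upwards [hopen.mem_nhds hlt] with y hy
      rw [(hδ0 _ (le_of_lt hy)).1, zero_smul]
    have h1 : h (k (u x)) = 0 := (hδ0 _ hlt.le).1
    have h2 : h' (k (u x)) = 0 := (hδ0 _ hlt.le).2
    have hz : (0 : ℝ) • fderiv ℝ u x +
        (0 : ℝ) • ((innerSL ℝ (u x)).comp (fderiv ℝ u x)).smulRight (u x) = 0 := by module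
    rw [h1, h2, mul_zero, zero_div, hz]
    exact (hasFDerivAt_const (0 : EuclideanSpace ℝ (Fin 3)) x).congr_of_eventuallyEq hev
  · -- `|u x| > c`: chain rule through `k(u) = 1 - c/|u|`
    have hkpos : 0 < k (u x) := hδ.trans_le hge
    have hcu : c < ‖u x‖ := by rw [hkx] at hkpos; exact (weight_pos_iff hc _).1 hkpos
    have hux : u x ≠ 0 := by
      intro h0; rw [h0, norm_zero] at hcu; exact absurd hcu (not_lt.2 hc.le)
    have hun : 0 < ‖u x‖ := norm_pos_iff.2 hux
    have hmax : max ‖u x‖ c = ‖u x‖ := max_eq_left hcu.le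
    have hN : HasFDerivAt (fun y => ‖u y‖) ((‖u x‖⁻¹ • innerSL ℝ (u x)).comp (fderiv ℝ u x)) x :=
      (hasFDerivAt_norm_of_ne_zero hux).comp x (hud x).hasFDerivAt
    have hφ : HasDerivAt (fun s : ℝ => 1 - c * s⁻¹) (c * (‖u x‖ ^ 2)⁻¹) ‖u x‖ := by
      have := ((hasDerivAt_inv hun.ne').const_mul c).const_sub 1
      simpa using this
    have hopen : IsOpen {y | c < ‖u y‖} := isOpen_lt continuous_const (continuous_norm.comp cu)
    have hkev : (fun y => k (u y)) =ᶠ[𝓝 x] ((fun s : ℝ => 1 - c * s⁻¹) ∘ fun y => ‖u y‖) := by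
      filter_upwards [hopen.mem_nhds hcu] with y hy
      rw [Function.comp_apply, hkx, weight_eq_of_le_norm hc _ (le_of_lt hy), div_eq_mul_inv]
    have hcomp : HasFDerivAt ((fun s : ℝ => 1 - c * s⁻¹) ∘ fun y => ‖u y‖)
        ((c * (‖u x‖ ^ 2)⁻¹) • ((‖u x‖⁻¹ • innerSL ℝ (u x)).comp (fderiv ℝ u x))) x :=
      hφ.comp_hasFDerivAt x hN
    have hku : HasFDerivAt (fun y => k (u y))
        ((c * (‖u x‖ ^ 2)⁻¹) • ((‖u x‖⁻¹ • innerSL ℝ (u x)).comp (fderiv ℝ u x))) x :=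
      hcomp.congr_of_eventuallyEq hkev
    have hknD : HasFDerivAt (fun y => h (k (u y)))
        (h' (k (u x)) • ((c * (‖u x‖ ^ 2)⁻¹) •
          ((‖u x‖⁻¹ • innerSL ℝ (u x)).comp (fderiv ℝ u x)))) x :=
      (hder (k (u x))).comp_hasFDerivAt x hku
    have hwnD := hknD.smul (hud x).hasFDerivAt
    refine hwnD.congr_fderiv (ContinuousLinearMap.ext fun w => ?_)
    simp only [add_apply, smul_apply, ContinuousLinearMap.smulRight_apply,
      ContinuousLinearMap.comp_apply, innerSL_apply_apply, smul_eq_mul, hmax]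
    match_scalars <;> ring

/-- **The regularised viscous inequality.** For `u ∈ C²(ℝ³)` with `u, Du, D²u ∈ L²`, `c > 0`, and a
regularised truncation `h` (differentiable, `h`, `h'` continuous and vanishing on `(-∞, δ]` with
`δ > 0`, `0 ≤ h(y) ≤ y` for `y ≥ 0`, `|h'| ≤ M`):
`∫ h(k₀(u)) ⟪Δu, u⟫ ≤ -∫ (h(k₀) + h'(k₀)(1 - k₀)) G`, `G = Σᵢ⟪u, ∂ᵢu⟫² / max(|u|,c)²`
(whole-space integration by parts with the test field `h(k₀(u)) u`, whose derivative is
`hasFDerivAt_regularisedField`, and `G ≤ |∇u|²`). -/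
theorem viscous_step {c : ℝ} (hc : 0 < c)
    {u : EuclideanSpace ℝ (Fin 3) → EuclideanSpace ℝ (Fin 3)} (hu : ContDiff ℝ 2 u)
    (h0 : ∫⁻ x, ‖u x‖ₑ ^ 2 < ⊤) (h1 : ∫⁻ x, ‖iteratedFDeriv ℝ 1 u x‖ₑ ^ 2 < ⊤)
    (h2 : ∫⁻ x, ‖iteratedFDeriv ℝ 2 u x‖ₑ ^ 2 < ⊤)
    {h h' : ℝ → ℝ} {M δ : ℝ} (hder : ∀ y, HasDerivAt h (h' y) y) (hch : Continuous h)
    (hch' : Continuous h') (hδ : 0 < δ) (hδ0 : ∀ y, y ≤ δ → h y = 0 ∧ h' y = 0)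
    (hbd : ∀ y, 0 ≤ y → 0 ≤ h y ∧ h y ≤ y) (hM : ∀ y, |h' y| ≤ M) :
    ∫ x, h (max (‖u x‖ - c) 0 / max ‖u x‖ c) * ⟪(Δ u) x, u x⟫ ≤
      -∫ x, (h (max (‖u x‖ - c) 0 / max ‖u x‖ c) +
          h' (max (‖u x‖ - c) 0 / max ‖u x‖ c) * (1 - max (‖u x‖ - c) 0 / max ‖u x‖ c)) *
        ((∑ i, ⟪u x, fderiv ℝ u x (EuclideanSpace.basisFun (Fin 3) ℝ i)⟫ ^ 2) /
          max ‖u x‖ c ^ 2) := by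
  set e := EuclideanSpace.basisFun (Fin 3) ℝ with he
  obtain ⟨k, hk⟩ : ∃ k : EuclideanSpace ℝ (Fin 3) → ℝ, k = fun v => max (‖v‖ - c) 0 / max ‖v‖ c :=
    ⟨_, rfl⟩
  obtain ⟨G, hG⟩ : ∃ G : EuclideanSpace ℝ (Fin 3) → ℝ,
      G = fun x => (∑ i, ⟪u x, fderiv ℝ u x (e i)⟫ ^ 2) / max ‖u x‖ c ^ 2 := ⟨_, rfl⟩
  have hkx : ∀ v, k v = max (‖v‖ - c) 0 / max ‖v‖ c := fun v => by rw [hk]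
  have hGx : ∀ x, G x = (∑ i, ⟪u x, fderiv ℝ u x (e i)⟫ ^ 2) / max ‖u x‖ c ^ 2 := fun x => by
    rw [hG]
  simp only [← hkx, ← hGx]
  have hM0 : 0 ≤ M := (abs_nonneg _).trans (hM 0)
  -- regularity of `u`
  have hud : Differentiable ℝ u := (hu.of_le one_le_two).differentiable one_ne_zero
  have cu : Continuous u := hu.continuous
  have cDu : Continuous (fderiv ℝ u) := hu.continuous_fderiv (by norm_num)
  have cdi : ∀ i, Continuous fun x => fderiv ℝ u x (e i) := fun i => cDu.clm_apply continuous_const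
  have hdfi : ∀ i, Differentiable ℝ (fun y => fderiv ℝ u y (e i)) := fun i =>
    ((hu.fderiv_right (m := 1) le_rfl).clm_apply contDiff_const).differentiable one_ne_zero
  have cddi : ∀ i, Continuous fun x => fderiv ℝ (fun y => fderiv ℝ u y (e i)) x (e i) := fun i =>
    (((hu.fderiv_right (m := 1) le_rfl).clm_apply contDiff_const).continuous_fderiv
      one_ne_zero).clm_apply continuous_const
  have cΔ : Continuous (Δ u) := continuous_laplacian hu
  have cku : Continuous fun x => k (u x) := by rw [hk]; exact (continuous_weight hc).comp cu
  have cmax : Continuous fun x => max ‖u x‖ c := by fun_prop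
  have hmaxpos : ∀ x, 0 < max ‖u x‖ c := fun x => lt_of_lt_of_le hc (le_max_right _ _)
  have hk01 : ∀ x, 0 ≤ k (u x) ∧ k (u x) ≤ 1 := fun x => by
    rw [hkx]; exact ⟨weight_nonneg hc _, weight_le_one hc _⟩
  have hkn01 : ∀ x, 0 ≤ h (k (u x)) ∧ h (k (u x)) ≤ 1 := fun x =>
    ⟨(hbd _ (hk01 x).1).1, (hbd _ (hk01 x).1).2.trans (hk01 x).2⟩
  have cG : Continuous G := by
    rw [hG]
    exact Continuous.div (by fun_prop) (cmax.pow 2) fun x => (pow_pos (hmaxpos x) 2).ne'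
  have hG0 : ∀ x, 0 ≤ G x := fun x => by
    rw [hGx]; exact div_nonneg (Finset.sum_nonneg fun i _ => sq_nonneg _) (sq_nonneg _)
  -- `L²` facts
  have l2di : ∀ i, ∫⁻ x, ‖fderiv ℝ u x (e i)‖ₑ ^ 2 < ⊤ := fun i =>
    lintegral_enorm_sq_lt_top_of_norm_le (fun x => norm_fderiv_apply_basisFun_le u x i) h1
  have l2ddi : ∀ i, ∫⁻ x, ‖fderiv ℝ (fun y => fderiv ℝ u y (e i)) x (e i)‖ₑ ^ 2 < ⊤ := fun i =>
    lintegral_enorm_sq_lt_top_of_norm_le (fun x => norm_fderiv_fderiv_apply_basisFun_le hu x i) h2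
  -- the test field `w = h(k₀(u)) u`, its derivative, the coefficient `A`
  obtain ⟨A, hA⟩ : ∃ A : EuclideanSpace ℝ (Fin 3) → ℝ,
      A = fun x => c * h' (k (u x)) / max ‖u x‖ c ^ 3 := ⟨_, rfl⟩
  have hAx : ∀ x, A x = c * h' (k (u x)) / max ‖u x‖ c ^ 3 := fun x => by rw [hA]
  obtain ⟨w, hw⟩ : ∃ w : EuclideanSpace ℝ (Fin 3) → EuclideanSpace ℝ (Fin 3),
      w = fun x => h (k (u x)) • u x := ⟨_, rfl⟩
  obtain ⟨w', hw'⟩ : ∃ w' : EuclideanSpace ℝ (Fin 3) →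
      EuclideanSpace ℝ (Fin 3) →L[ℝ] EuclideanSpace ℝ (Fin 3),
      w' = fun x => h (k (u x)) • fderiv ℝ u x +
        A x • ((innerSL ℝ (u x)).comp (fderiv ℝ u x)).smulRight (u x) := ⟨_, rfl⟩
  have hwx : ∀ x, w x = h (k (u x)) • u x := fun x => by rw [hw]
  have hw'app : ∀ x v, w' x v = h (k (u x)) • fderiv ℝ u x v + (A x * ⟪u x, fderiv ℝ u x v⟫) • u x := by
    intro x v
    rw [hw']
    simp only [add_apply, smul_apply, ContinuousLinearMap.smulRight_apply,
      ContinuousLinearMap.comp_apply, innerSL_apply_apply, smul_smul]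
  have hderivw : ∀ x, HasFDerivAt w (w' x) x := fun x => by
    simp only [hw, hw', hAx, hkx]
    exact hasFDerivAt_regularisedField hc hud hder hδ hδ0 x
  have cA : Continuous A := by
    rw [hA]
    exact Continuous.div (continuous_const.mul (hch'.comp cku)) (cmax.pow 3)
      fun x => (pow_pos (hmaxpos x) 3).ne'
  have chk : Continuous fun x => h (k (u x)) := hch.comp cku
  have cw : Continuous w := by rw [hw]; exact chk.smul cu
  have cw'i : ∀ i, Continuous fun x => w' x (e i) := fun i => by
    simp_rw [hw'app]
    exact (chk.smul (cdi i)).add ((cA.mul (cu.inner (cdi i))).smul cu)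
  have hAb : ∀ x, |A x| * ‖u x‖ ^ 2 ≤ M := fun x => by
    have hm := hmaxpos x
    rw [hAx, abs_div, abs_mul, abs_of_pos hc, abs_of_pos (pow_pos hm 3), div_mul_eq_mul_div,
      div_le_iff₀ (pow_pos hm 3)]
    calc c * |h' (k (u x))| * ‖u x‖ ^ 2 ≤ max ‖u x‖ c * M * max ‖u x‖ c ^ 2 := by
          gcongr
          · exact le_max_right _ _
          · exact hM _
          · exact le_max_left _ _
      _ = M * max ‖u x‖ c ^ 3 := by ring
  have hwn : ∀ x, ‖w x‖ ≤ ‖u x‖ := fun x => by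
    rw [hwx, norm_smul, Real.norm_of_nonneg (hkn01 x).1]
    exact mul_le_of_le_one_left (norm_nonneg _) (hkn01 x).2
  -- integrability of the three pairings
  have I1 : ∀ i, Integrable (fun x => ⟪fderiv ℝ (fun y => fderiv ℝ u y (e i)) x (e i), w x⟫)
      volume := fun i =>
    integrable_of_norm_le_mul_of_lintegral_sq ((cddi i).inner cw).aestronglyMeasurable
      (cddi i) cu (l2ddi i) h0 fun x =>
      (norm_inner_le_norm _ _).trans (mul_le_mul_of_nonneg_left (hwn x) (norm_nonneg _))
  have I2 : ∀ i, Integrable (fun x => ⟪fderiv ℝ u x (e i), w' x (e i)⟫) volume := fun i => by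
    have cb : Continuous fun x => (1 + M) • fderiv ℝ u x (e i) := (cdi i).const_smul (1 + M)
    have l2b : ∫⁻ x, ‖(1 + M) • fderiv ℝ u x (e i)‖ₑ ^ 2 < ⊤ :=
      lintegral_enorm_sq_const_smul_lt_top (1 + M) (l2di i)
    refine integrable_of_norm_le_mul_of_lintegral_sq (b := fun x => (1 + M) • fderiv ℝ u x (e i))
      ((cdi i).inner (cw'i i)).aestronglyMeasurable (cdi i) cb (l2di i) l2b fun x => ?_
    refine (norm_inner_le_norm _ _).trans (mul_le_mul_of_nonneg_left ?_ (norm_nonneg _))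
    rw [hw'app, norm_smul, Real.norm_of_nonneg (by linarith : (0 : ℝ) ≤ 1 + M), add_mul, one_mul]
    refine (norm_add_le _ _).trans (add_le_add ?_ ?_)
    · rw [norm_smul, Real.norm_of_nonneg (hkn01 x).1]
      exact mul_le_of_le_one_left (norm_nonneg _) (hkn01 x).2
    · rw [norm_smul, Real.norm_eq_abs, abs_mul]
      calc |A x| * |⟪u x, fderiv ℝ u x (e i)⟫| * ‖u x‖
          ≤ |A x| * (‖u x‖ * ‖fderiv ℝ u x (e i)‖) * ‖u x‖ := by
            gcongr; exact abs_real_inner_le_norm _ _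
        _ = (|A x| * ‖u x‖ ^ 2) * ‖fderiv ℝ u x (e i)‖ := by ring
        _ ≤ M * ‖fderiv ℝ u x (e i)‖ := mul_le_mul_of_nonneg_right (hAb x) (norm_nonneg _)
  have I3 : ∀ i, Integrable (fun x => ⟪fderiv ℝ u x (e i), w x⟫) volume := fun i =>
    integrable_of_norm_le_mul_of_lintegral_sq ((cdi i).inner cw).aestronglyMeasurable
      (cdi i) cu (l2di i) h0 fun x =>
      (norm_inner_le_norm _ _).trans (mul_le_mul_of_nonneg_left (hwn x) (norm_nonneg _))
  -- integration by parts, coordinatewise, and summation: `∫ Σᵢ⟪∂ᵢu, ∂ᵢw⟫ = -∫ h(k₀)⟪Δu, u⟫`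
  have hIBP : ∀ i, ∫ x, ⟪fderiv ℝ u x (e i), w' x (e i)⟫ =
      -∫ x, ⟪fderiv ℝ (fun y => fderiv ℝ u y (e i)) x (e i), w x⟫ := fun i =>
    integral_bilinear_hasFDerivAt_right_eq_neg_left_of_integrable (μ := volume)
      (B := (innerSL ℝ : EuclideanSpace ℝ (Fin 3) →L[ℝ] EuclideanSpace ℝ (Fin 3) →L[ℝ] ℝ))
      (f := fun y => fderiv ℝ u y (e i)) (g := w) (v := e i) (by exact I1 i) (by exact I2 i)
      (by exact I3 i) (fun x _ => (hdfi i x).hasFDerivAt) (fun x _ => hderivw x)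
  have hsumIBP : ∫ x, ∑ i, ⟪fderiv ℝ u x (e i), w' x (e i)⟫ =
      -∫ x, h (k (u x)) * ⟪(Δ u) x, u x⟫ := by
    rw [integral_finsetSum _ fun i _ => I2 i]
    simp_rw [hIBP]
    rw [Finset.sum_neg_distrib, ← integral_finsetSum _ fun i _ => I1 i]
    congr 1
    refine integral_congr_ae (Eventually.of_forall fun x => ?_)
    show ∑ i, ⟪fderiv ℝ (fun y => fderiv ℝ u y (e i)) x (e i), w x⟫ = h (k (u x)) * ⟪(Δ u) x, u x⟫
    rw [laplacian_eq_sum_fderiv_fderiv e hu x, sum_inner, Finset.mul_sum]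
    refine Finset.sum_congr rfl fun i _ => ?_
    rw [hwx, real_inner_smul_right]
  -- the pointwise lower bound `(h + h'(1-k₀)) G ≤ Σᵢ ⟪∂ᵢu, ∂ᵢw⟫`
  have hpt : ∀ x, (h (k (u x)) + h' (k (u x)) * (1 - k (u x))) * G x ≤
      ∑ i, ⟪fderiv ℝ u x (e i), w' x (e i)⟫ := by
    intro x
    have hsum : ∑ i, ⟪fderiv ℝ u x (e i), w' x (e i)⟫ =
        h (k (u x)) * (∑ i, ‖fderiv ℝ u x (e i)‖ ^ 2) + h' (k (u x)) * (1 - k (u x)) * G x := by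
      have h1 : ∀ i, ⟪fderiv ℝ u x (e i), w' x (e i)⟫ =
          h (k (u x)) * ‖fderiv ℝ u x (e i)‖ ^ 2 + A x * ⟪u x, fderiv ℝ u x (e i)⟫ ^ 2 := by
        intro i
        rw [hw'app, inner_add_right, real_inner_smul_right, real_inner_smul_right,
          real_inner_self_eq_norm_sq, real_inner_comm (fderiv ℝ u x (e i)) (u x)]
        ring
      simp_rw [h1]
      rw [Finset.sum_add_distrib, ← Finset.mul_sum, ← Finset.mul_sum]
      congr 1
      rw [hAx, hGx, hkx, ← div_max_eq_one_sub_weight hc (u x)]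
      have hm := (hmaxpos x).ne'
      field_simp
    rw [hsum, add_mul]
    have hGF : G x ≤ ∑ i, ‖fderiv ℝ u x (e i)‖ ^ 2 := by rw [hGx]; exact levelGradSq_le_sum_sq hc u x
    nlinarith [mul_le_mul_of_nonneg_left hGF (hkn01 x).1]
  -- integrate
  have iS : Integrable (fun x => ∑ i, ⟪fderiv ℝ u x (e i), w' x (e i)⟫) volume :=
    integrable_finsetSum _ fun i _ => I2 i
  have iG : Integrable G volume := by
    have iF : Integrable (fun x => ∑ i, ‖fderiv ℝ u x (e i)‖ ^ 2) volume :=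
      integrable_finsetSum _ fun i _ => integrable_sq_norm_of_lintegral_lt_top (cdi i) (l2di i)
    exact iF.mono' cG.aestronglyMeasurable (Eventually.of_forall fun x => by
      rw [Real.norm_of_nonneg (hG0 x), hGx]; exact levelGradSq_le_sum_sq hc u x)
  have cm : Continuous fun x => (h (k (u x)) + h' (k (u x)) * (1 - k (u x))) * G x :=
    (chk.add ((hch'.comp cku).mul (continuous_const.sub cku))).mul cG
  have imG : Integrable (fun x => (h (k (u x)) + h' (k (u x)) * (1 - k (u x))) * G x) volume := by
    refine (iG.const_mul (1 + M)).mono' cm.aestronglyMeasurable (Eventually.of_forall fun x => ?_)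
    rw [Real.norm_eq_abs, abs_mul, abs_of_nonneg (hG0 x)]
    refine mul_le_mul_of_nonneg_right ?_ (hG0 x)
    calc |h (k (u x)) + h' (k (u x)) * (1 - k (u x))|
        ≤ |h (k (u x))| + |h' (k (u x)) * (1 - k (u x))| := abs_add_le _ _
      _ = |h (k (u x))| + |h' (k (u x))| * |1 - k (u x)| := by rw [abs_mul]
      _ ≤ 1 + M * 1 := by
          gcongr
          · rw [abs_of_nonneg (hkn01 x).1]; exact (hkn01 x).2
          · exact hM _
          · rw [abs_of_nonneg (by linarith [(hk01 x).2])]; linarith [(hk01 x).1]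
      _ = 1 + M := by ring
  have hle := integral_mono imG iS hpt
  rw [hsumIBP] at hle
  linarith

end Summit.NavierStokesRegularity.NavierStokesRegularity.Theorems.LevelSetEnergyInequality

end
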